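import Literature.MathematicalPhysics.QuantumFieldTheory.OSTemperedRecursion
import Literature.MathematicalPhysics.QuantumFieldTheory.OSLabelledLevelZero
import HarnessLib

/-!
# The temperedness induction of OS II, Ch. VI.2: the bound (6.28) at the first level

Topic `Literature/MathematicalPhysics/QuantumFieldTheory`; support file (all proved; the weighted
flat-tube data and the explicit constant as definitions; no named facts) for the discharge of (A1)
`OS1975_exists_timeContinuation`. Osterwalder–Schrader II (Comm. Math. Phys. 42 (1975)), Ch. VI.2:
*"We prove (6.28) by induction. For `N = 0`, (6.28) follows from inequality (6.20)"* — (6.20) being the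
real-point bound (4.5) `‖S_k(ξ)‖ ≤ α (1 + ∑ξᵢ)^{βk} (1 + ∑ξᵢ⁻¹)^{βk}` with **exponent linear in `k`**
(this is where the linear growth condition E0' enters). In the regions of `OSEnvelopeBases` the first
level `c_k^{(1)} = {∑|arg ζᵢ| < π/2}` is reached from the real points by the flat tube theorem, so the
start of the induction is the bound of the regularised function `S_{k,ε} = ω_k · S_k(· + ε⃗)` (6.21) on
the whole of `c_k^{(1)}`, obtained here by the **growth-free maximum principle on the flat tubes**
(`IsSectorData.norm_extension_le`, `OSSectorContinuation`) from its bounds at the real points and on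
the flat tubes — where the one-gap continuation (5.4) is bounded by the Schwarz inequality through
real-point values *independent of `Im τ`* and the weight decays in `Re` only:

* `core_pow_bound` — the elementary estimate `X^{tk} (B^{kT})⁻¹ ≤ (3k+1)^{tk}` for `X ≤ (3k+1)B`,
  `B ≥ 1`, `t ≤ T`;
* `wSdat`, `wEdat` — the weighted shifted real-point function and flat-tube continuations, and
  `isSectorData_weighted` — they are (bounded) sector data of opening `π/2`;
* `lev0Const CT α t k ε = Â_k (1 + 4k/ε)^{tk} (3k+1)^{tk}` with
  `Â_k = max (α k) (max CT 0 · ∑ᵢ √(α_{2i+1} α_{2(k-1-i)+1}))`;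
* `norm_regFun_le_levelZero` — **(6.28) at `N = 0`**: for any family `Sfam` holomorphic on `ℂ₊ᵏ` and
  equal to `S₀` at the positive real points, `‖S_{k,ε}(Z)‖ ≤ lev0Const` on the region of `c_k^{(1)}`,
  for `0 < ε ≤ 1`, `t ≤ T`, all `k ≥ 1` and all good labels.

## References

* K. Osterwalder, R. Schrader, *Axioms for Euclidean Green's functions II*, Comm. Math. Phys.
  42 (1975) 281–305, Thm. 4.1 (4.5), Ch. V (5.4), Ch. VI.2 (6.20)–(6.22), (6.28). [OsterwalderSchraderCMP1975]
-/

noncomputable section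

open Metric Set Filter Complex
open scoped Topology ComplexConjugate InnerProductSpace BigOperators

namespace Literature.MathematicalPhysics.QuantumFieldTheory.OSEnvelope

open Literature.Analysis.Complex Literature.MathematicalPhysics.QuantumFieldTheory
  Literature.MathematicalPhysics.QuantumFieldTheory.LogSlot

variable {E : Type*} {H : Type*} [NormedAddCommGroup H] [InnerProductSpace ℂ H]

/-! ### Elementary estimates -/

/-- **The core estimate**: `X^{tk} (B^{kT})⁻¹ ≤ Λ^{tk}` whenever `0 ≤ X ≤ Λ B`, `1 ≤ B`, `t ≤ T`. [folklore] -/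
theorem core_pow_bound {X B Λ : ℝ} {k t T : ℕ} (hX0 : 0 ≤ X) (hX : X ≤ Λ * B) (hB : 1 ≤ B) (htT : t ≤ T) :
    X ^ (t * k) * (B ^ (k * T))⁻¹ ≤ Λ ^ (t * k) := by
  have hB0 : 0 < B := lt_of_lt_of_le one_pos hB
  have hΛ : 0 ≤ Λ := by
    by_contra h
    push Not at h
    have : Λ * B < 0 := mul_neg_of_neg_of_pos h hB0
    linarith
  rw [mul_inv_le_iff₀ (pow_pos hB0 _)]
  calc X ^ (t * k) ≤ (Λ * B) ^ (t * k) := pow_le_pow_left₀ hX0 hX _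
    _ = Λ ^ (t * k) * B ^ (t * k) := mul_pow _ _ _
    _ ≤ Λ ^ (t * k) * B ^ (k * T) := by
        refine mul_le_mul_of_nonneg_left (pow_le_pow_right₀ hB ?_) (by positivity)
        calc t * k ≤ T * k := Nat.mul_le_mul_right k htT
          _ = k * T := Nat.mul_comm _ _

/-- Sums of inverses of entries bounded below: `∑ eᵢ⁻¹ ≤ n · (2/ε)` if `eᵢ ≥ ε/2 > 0`. [folklore] -/
theorem sum_inv_le_of_ge {n : ℕ} {e : Fin n → ℝ} {ε : ℝ} (hε : 0 < ε) (he : ∀ i, ε / 2 ≤ e i) :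
    ∑ i, (e i)⁻¹ ≤ n * (2 / ε) := by
  calc ∑ i, (e i)⁻¹ ≤ ∑ _i : Fin n, 2 / ε := Finset.sum_le_sum fun i _ => by
        rw [← one_div, div_le_div_iff₀ (lt_of_lt_of_le (by positivity) (he i)) hε]
        linarith [he i]
    _ = n * (2 / ε) := by rw [Finset.sum_const, Finset.card_univ, Fintype.card_fin, nsmul_eq_mul]

/-- Sum of the entries of `insertNth`. [folklore] -/
theorem sum_insertNth {α : Type*} [AddCommMonoid α] {m : ℕ} (i : Fin (m + 1)) (x : α) (u : Fin m → α) :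
    ∑ j, (i.insertNth x u : Fin (m + 1) → α) j = x + ∑ j, u j := by
  rw [Fin.sum_univ_succAbove _ i, Fin.insertNth_apply_same]
  simp only [Fin.insertNth_apply_succAbove]

/-- Sum over the real blocks `Lr i u'`: at most the sum over `u'` (nonnegative entries). [folklore] -/
theorem sum_Lr_le {m : ℕ} (i : Fin (m + 1)) {u : Fin m → ℝ} (hu : ∀ j, 0 ≤ u j) :
    ∑ j, Lr i u j ≤ ∑ j, u j := by
  -- `Lr i u` is `u` along an injection
  have hinj : Function.Injective fun j : Fin i => (⟨i - 1 - j, by omega⟩ : Fin m) := by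
    intro a b hab; simp only [Fin.mk.injEq] at hab; ext; omega
  calc ∑ j, Lr i u j = ∑ j : Fin i, u ((fun j : Fin i => (⟨i - 1 - j, by omega⟩ : Fin m)) j) := rfl
    _ = ∑ j ∈ Finset.univ.image (fun j : Fin i => (⟨i - 1 - j, by omega⟩ : Fin m)), u j := by
        rw [Finset.sum_image fun a _ b _ hab => hinj hab]
    _ ≤ ∑ j, u j := Finset.sum_le_sum_of_subset_of_nonneg (Finset.subset_univ _) fun j _ _ => hu j

/-- Sum over the real blocks `Rr i u'`: at most the sum over `u'` (nonnegative entries). [folklore] -/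
theorem sum_Rr_le {m : ℕ} (i : Fin (m + 1)) {u : Fin m → ℝ} (hu : ∀ j, 0 ≤ u j) :
    ∑ j, Rr i u j ≤ ∑ j, u j := by
  have hinj : Function.Injective fun j : Fin (m + 1 - 1 - i) =>
      (⟨(i : ℕ) + (j : ℕ), by have := j.2; omega⟩ : Fin m) := by
    intro a b hab; simp only [Fin.mk.injEq] at hab; ext; omega
  calc ∑ j, Rr i u j = ∑ j : Fin (m + 1 - 1 - i),
        u ((fun j : Fin (m + 1 - 1 - i) => (⟨(i : ℕ) + (j : ℕ), by have := j.2; omega⟩ : Fin m)) j) := rfl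
    _ = ∑ j ∈ Finset.univ.image (fun j : Fin (m + 1 - 1 - i) =>
          (⟨(i : ℕ) + (j : ℕ), by have := j.2; omega⟩ : Fin m)), u j := by
        rw [Finset.sum_image fun a _ b _ hab => hinj hab]
    _ ≤ ∑ j, u j := Finset.sum_le_sum_of_subset_of_nonneg (Finset.subset_univ _) fun j _ _ => hu j

/-! ### The Schwarz bound for the one-gap continuation through the sum-form real bounds -/

section SumBounds

variable {T : ℂ → H →L[ℂ] H} {CT : ℝ} {Φ : (n : ℕ) → (Fin (n + 1) → E) → ℝ → (Fin n → ℝ) → H}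
  {good : (k : ℕ) → (Fin (k + 1) → E) → Prop} {S₀ : (k : ℕ) → (Fin (k + 1) → E) → (Fin k → ℂ) → ℂ}
  {C₀ : ℕ → ℝ} {p₀ : ℕ → ℕ} {α : ℕ → ℝ} {t : ℕ}

/-- **Squared norms of the real-point vectors through the sum-form real bound**:
`‖Φ n a x ξ‖² ≤ α (2n+1) ((1 + ∑e)(1 + ∑e⁻¹))^{t(2n+1)}` for the Gram point `e = (ξ, 2x, ξ)`. [cite: OsterwalderSchraderCMP1975, Ch. VI.2 (6.20), (6.22)] -/
theorem IsOSLabelledRealData.norm_sq_vec_le_sum (hD : IsOSLabelledRealData good S₀ Φ C₀ p₀)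
    (hsum : ∀ (k : ℕ) (c : Fin (k + 1) → E), good k c → ∀ ρ : Fin k → ℝ, (∀ i, 0 < ρ i) →
      ‖S₀ k c (fun i => (ρ i : ℂ))‖ ≤ α k * ((1 + ∑ i, ρ i) * (1 + ∑ i, (ρ i)⁻¹)) ^ (t * k))
    (n : ℕ) {a : Fin (n + 1) → E} (ha : good (n + 1 + n) (dblPos a)) {x : ℝ} (hx : 0 < x)
    {ξ : Fin n → ℝ} (hξ : ∀ j, 0 < ξ j) :
    ‖Φ n a x ξ‖ ^ 2 ≤ α (n + 1 + n) *
      ((1 + ∑ i, cPlace ξ (2 * x) ξ i) * (1 + ∑ i, (cPlace ξ (2 * x) ξ i)⁻¹)) ^ (t * (n + 1 + n)) := by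
  rw [hD.norm_sq_vec n a hx ξ hξ]
  set ρ : Fin (n + 1 + n) → ℝ := cPlace ξ (2 * x) ξ with hρ
  have hρpos : ∀ i, 0 < ρ i := by
    intro i
    rcases lt_trichotomy (i : ℕ) n with h | h | h
    · rw [hρ, cPlace_apply_lt _ _ _ h]; exact hξ _
    · rw [hρ, cPlace_apply_mid _ _ _ h]; positivity
    · rw [hρ, cPlace_apply_gt _ _ _ h]; exact hξ _
  have hpt : cDiagEmbed (fun j => (ξ j : ℂ)) ((2 * x : ℝ) : ℂ) (fun j => (ξ j : ℂ)) = fun i => (ρ i : ℂ) := by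
    rw [cDiagEmbed_eq_cPlace, ← cPlace_map (fun r : ℝ => (r : ℂ))]
  rw [hpt]
  exact (Complex.re_le_norm _).trans (hsum _ _ ha ρ hρpos)

/-- **The Schwarz bound for the one-gap continuation (5.4) in terms of the sum-form real bounds**,
uniform in `Im τ`: with `Σ' = Re τ + ∑ u'ⱼ` and entries `≥ ε/2` (`u' ≥ ε`, `Re τ ≥ ε`, `0 < ε ≤ 1`),
`‖E_i(u', τ)‖ ≤ CT √(α_{2i+1} α_{2(m-i)+1}) ((1 + 3k + 2Σ')(1 + 4k/ε))^{tk}`, `k = m + 1`. [cite: OsterwalderSchraderCMP1975, Ch. VI.2 (6.20), (6.22)] -/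
theorem norm_slotE_le_sum (hT : IsOSSemigroup T CT) (hD : IsOSLabelledRealData good S₀ Φ C₀ p₀)
    (hgood : IsOSLabelSet good) (hα : ∀ k, 0 ≤ α k)
    (hsum : ∀ (k : ℕ) (c : Fin (k + 1) → E), good k c → ∀ ρ : Fin k → ℝ, (∀ i, 0 < ρ i) →
      ‖S₀ k c (fun i => (ρ i : ℂ))‖ ≤ α k * ((1 + ∑ i, ρ i) * (1 + ∑ i, (ρ i)⁻¹)) ^ (t * k))
    {m : ℕ} {c : Fin (m + 1 + 1) → E} (hc : good (m + 1) c) (i : Fin (m + 1))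
    {ε : ℝ} (hε0 : 0 < ε) {u' : Fin m → ℝ} (hu : ∀ j, ε ≤ u' j) {τ : ℂ} (hτ : ε ≤ τ.re) :
    ‖slotE T Φ c i u' τ‖ ≤ max CT 0 *
      Real.sqrt (α (i + 1 + i) * α (m + 1 - 1 - i + 1 + (m + 1 - 1 - i))) *
      ((1 + 3 * (m + 1 : ℕ) + 2 * (τ.re + ∑ j, u' j)) * (1 + 4 * (m + 1 : ℕ) / ε)) ^ (t * (m + 1)) := by
  have hu0 : ∀ j, 0 < u' j := fun j => lt_of_lt_of_le hε0 (hu j)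
  have hτ0 : 0 < τ.re := lt_of_lt_of_le hε0 hτ
  -- the canonical split
  set x : ℝ := τ.re / 4 with hx
  have hx0 : 0 < x := by positivity
  set τ' : ℂ := τ - ((τ.re / 2 : ℝ) : ℂ) with hτ'
  have hτ're : 0 < τ'.re := by simp only [hτ', Complex.sub_re, Complex.ofReal_re]; linarith
  have hslot : slotE T Φ c i u' τ =
      ⟪Φ i (posRevLeft c i) x (Lr i u'), T τ' (Φ (m + 1 - 1 - i) (posRight c i) x (Rr i u'))⟫_ℂ := rfl
  rw [hslot]
  set a : ℝ := ‖Φ i (posRevLeft c i) x (Lr i u')‖ with ha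
  set b : ℝ := ‖Φ (m + 1 - 1 - i) (posRight c i) x (Rr i u')‖ with hb
  have hSchwarz : ‖⟪Φ i (posRevLeft c i) x (Lr i u'), T τ' (Φ (m + 1 - 1 - i) (posRight c i) x (Rr i u'))⟫_ℂ‖ ≤
      max CT 0 * (a * b) := by
    calc ‖⟪Φ i (posRevLeft c i) x (Lr i u'), T τ' (Φ (m + 1 - 1 - i) (posRight c i) x (Rr i u'))⟫_ℂ‖
        ≤ a * ‖T τ' (Φ (m + 1 - 1 - i) (posRight c i) x (Rr i u'))‖ := norm_inner_le_norm _ _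
      _ ≤ a * (‖T τ'‖ * b) := mul_le_mul_of_nonneg_left ((T τ').le_opNorm _) (norm_nonneg _)
      _ ≤ a * (max CT 0 * b) := by
          refine mul_le_mul_of_nonneg_left (mul_le_mul_of_nonneg_right
            ((hT.norm_le τ' hτ're).trans (le_max_left _ _)) (norm_nonneg _)) (norm_nonneg _)
      _ = max CT 0 * (a * b) := by ring
  -- the common quantity `Q = (1 + 3k + 2Σ')(1 + 4k/ε)` dominates both Gram factors (`k = m + 1`)
  set Sg : ℝ := τ.re + ∑ j, u' j with hSg
  have hSg0 : 0 ≤ Sg := by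
    have : 0 ≤ ∑ j, u' j := Finset.sum_nonneg fun j _ => (hu0 j).le
    rw [hSg]; positivity
  have hk1 : (1 : ℝ) ≤ ((m + 1 : ℕ) : ℝ) := by exact_mod_cast Nat.succ_le_succ (Nat.zero_le m)
  set Q : ℝ := (1 + 3 * ((m + 1 : ℕ) : ℝ) + 2 * Sg) * (1 + 4 * ((m + 1 : ℕ) : ℝ) / ε) with hQ
  have hQ0 : 0 ≤ Q := by positivity
  -- a Gram factor `((1 + ∑e)(1 + ∑e⁻¹))` for a block `ξ` with `∑ξ ≤ ∑u'`, `ξ ≥ ε`, of `2n+1 ≤ 2k` entries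
  have hgram : ∀ {n : ℕ} (hn : n + 1 + n ≤ 2 * (m + 1)) {ξ : Fin n → ℝ} (hξε : ∀ j, ε ≤ ξ j)
      (hξsum : ∑ j, ξ j ≤ ∑ j, u' j),
      (1 + ∑ i, cPlace ξ (2 * x) ξ i) * (1 + ∑ i, (cPlace ξ (2 * x) ξ i)⁻¹) ≤ Q := by
    intro n hn ξ hξε hξsum
    have hn' : ((n + 1 + n : ℕ) : ℝ) ≤ 2 * ((m + 1 : ℕ) : ℝ) := by exact_mod_cast hn
    have he : ∀ i, ε / 2 ≤ cPlace ξ (2 * x) ξ i := by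
      intro i
      rcases lt_trichotomy (i : ℕ) n with h | h | h
      · rw [cPlace_apply_lt _ _ _ h]; exact le_trans (by linarith) (hξε _)
      · rw [cPlace_apply_mid _ _ _ h, hx]; linarith
      · rw [cPlace_apply_gt _ _ _ h]; exact le_trans (by linarith) (hξε _)
    have h1 : 1 + ∑ i, cPlace ξ (2 * x) ξ i ≤ 1 + 3 * ((m + 1 : ℕ) : ℝ) + 2 * Sg := by
      rw [sum_cPlace, hx, hSg]
      have : 0 ≤ ∑ j, u' j := Finset.sum_nonneg fun j _ => (hu0 j).le
      linarith [hξsum, hτ0, hk1]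
    have h2 : 1 + ∑ i, (cPlace ξ (2 * x) ξ i)⁻¹ ≤ 1 + 4 * ((m + 1 : ℕ) : ℝ) / ε := by
      have h := sum_inv_le_of_ge hε0 he
      have h3 : ((n + 1 + n : ℕ) : ℝ) * (2 / ε) ≤ 2 * ((m + 1 : ℕ) : ℝ) * (2 / ε) :=
        mul_le_mul_of_nonneg_right hn' (by positivity)
      have h4 : 2 * ((m + 1 : ℕ) : ℝ) * (2 / ε) = 4 * ((m + 1 : ℕ) : ℝ) / ε := by ring
      linarith [h, h3, h4]
    have h10 : 0 ≤ 1 + ∑ i, cPlace ξ (2 * x) ξ i := by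
      have : 0 ≤ ∑ i, cPlace ξ (2 * x) ξ i :=
        Finset.sum_nonneg fun i _ => (lt_of_lt_of_le (by positivity) (he i)).le
      linarith
    have h20 : 0 ≤ 1 + ∑ i, (cPlace ξ (2 * x) ξ i)⁻¹ := by
      have : 0 ≤ ∑ i, (cPlace ξ (2 * x) ξ i)⁻¹ :=
        Finset.sum_nonneg fun i _ => (inv_pos.2 (lt_of_lt_of_le (by positivity) (he i))).le
      linarith
    rw [hQ]
    exact mul_le_mul h1 h2 h20 (by positivity)
  -- the two squared norms
  have hl : good (i + 1 + i) (dblPos (posRevLeft c i)) := hgood.left (m + 1) c i hc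
  have hr : good (m + 1 - 1 - i + 1 + (m + 1 - 1 - i)) (dblPos (posRight c i)) := hgood.right (m + 1) c i hc
  have hLε : ∀ j, ε ≤ Lr i u' j := fun j => hu _
  have hRε : ∀ j, ε ≤ Rr i u' j := fun j => hu _
  have hLsum := sum_Lr_le i (u := u') fun j => (hu0 j).le
  have hRsum := sum_Rr_le i (u := u') fun j => (hu0 j).le
  set eL : ℕ := i + 1 + i with heL
  set eR : ℕ := m + 1 - 1 - i + 1 + (m + 1 - 1 - i) with heR
  have heLk : eL ≤ 2 * (m + 1) := by rw [heL]; have := i.2; omega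
  have heRk : eR ≤ 2 * (m + 1) := by rw [heR]; have := i.2; omega
  have heLR : eL + eR = 2 * (m + 1) := by rw [heL, heR]; have := i.2; omega
  have ha2 : a ^ 2 ≤ α eL * Q ^ (t * eL) := by
    have h := hD.norm_sq_vec_le_sum hsum i hl hx0 (Lr_pos i hu0)
    refine h.trans (mul_le_mul_of_nonneg_left (pow_le_pow_left₀ ?_ (hgram heLk hLε hLsum) _) (hα _))
    have he : ∀ j, ε / 2 ≤ cPlace (Lr i u') (2 * x) (Lr i u') j := by
      intro j
      rcases lt_trichotomy (j : ℕ) i with h | h | h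
      · rw [cPlace_apply_lt _ _ _ h]; exact le_trans (by linarith) (hLε _)
      · rw [cPlace_apply_mid _ _ _ h, hx]; linarith
      · rw [cPlace_apply_gt _ _ _ h]; exact le_trans (by linarith) (hLε _)
    have h10 : 0 ≤ ∑ j, cPlace (Lr i u') (2 * x) (Lr i u') j :=
      Finset.sum_nonneg fun j _ => (lt_of_lt_of_le (by positivity) (he j)).le
    have h20 : 0 ≤ ∑ j, (cPlace (Lr i u') (2 * x) (Lr i u') j)⁻¹ :=
      Finset.sum_nonneg fun j _ => (inv_pos.2 (lt_of_lt_of_le (by positivity) (he j))).le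
    exact mul_nonneg (by linarith) (by linarith)
  have hb2 : b ^ 2 ≤ α eR * Q ^ (t * eR) := by
    have h := hD.norm_sq_vec_le_sum hsum (m + 1 - 1 - i) hr hx0 (Rr_pos i hu0)
    refine h.trans (mul_le_mul_of_nonneg_left (pow_le_pow_left₀ ?_ (hgram heRk hRε hRsum) _) (hα _))
    have he : ∀ j, ε / 2 ≤ cPlace (Rr i u') (2 * x) (Rr i u') j := by
      intro j
      rcases lt_trichotomy (j : ℕ) (m + 1 - 1 - i) with h | h | h
      · rw [cPlace_apply_lt _ _ _ h]; exact le_trans (by linarith) (hRε _)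
      · rw [cPlace_apply_mid _ _ _ h, hx]; linarith
      · rw [cPlace_apply_gt _ _ _ h]; exact le_trans (by linarith) (hRε _)
    have h10 : 0 ≤ ∑ j, cPlace (Rr i u') (2 * x) (Rr i u') j :=
      Finset.sum_nonneg fun j _ => (lt_of_lt_of_le (by positivity) (he j)).le
    have h20 : 0 ≤ ∑ j, (cPlace (Rr i u') (2 * x) (Rr i u') j)⁻¹ :=
      Finset.sum_nonneg fun j _ => (inv_pos.2 (lt_of_lt_of_le (by positivity) (he j))).le
    exact mul_nonneg (by linarith) (by linarith)
  -- `ab ≤ √(α_L α_R) Q^{tk}`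
  have hab : a * b ≤ Real.sqrt (α eL * α eR) * Q ^ (t * (m + 1)) := by
    have hab2 : (a * b) ^ 2 ≤ (α eL * α eR) * (Q ^ (t * (m + 1))) ^ 2 := by
      calc (a * b) ^ 2 = a ^ 2 * b ^ 2 := by ring
        _ ≤ (α eL * Q ^ (t * eL)) * (α eR * Q ^ (t * eR)) :=
            mul_le_mul ha2 hb2 (sq_nonneg _) (mul_nonneg (hα eL) (pow_nonneg hQ0 _))
        _ = (α eL * α eR) * (Q ^ (t * eL) * Q ^ (t * eR)) := by ring
        _ = (α eL * α eR) * (Q ^ (t * (m + 1))) ^ 2 := by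
            rw [← pow_add, ← mul_add, heLR, show t * (2 * (m + 1)) = t * (m + 1) * 2 by ring, pow_mul]
    have ha0 : 0 ≤ a := norm_nonneg _
    have hb0 : 0 ≤ b := norm_nonneg _
    have h := Real.abs_le_sqrt hab2
    rw [abs_of_nonneg (mul_nonneg ha0 hb0), Real.sqrt_mul' _ (sq_nonneg _),
      Real.sqrt_sq (pow_nonneg hQ0 _)] at h
    exact h
  calc ‖⟪Φ i (posRevLeft c i) x (Lr i u'), T τ' (Φ (m + 1 - 1 - i) (posRight c i) x (Rr i u'))⟫_ℂ‖
      ≤ max CT 0 * (a * b) := hSchwarz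
    _ ≤ max CT 0 * (Real.sqrt (α eL * α eR) * Q ^ (t * (m + 1))) := mul_le_mul_of_nonneg_left hab (le_max_right _ _)
    _ = max CT 0 * Real.sqrt (α eL * α eR) * Q ^ (t * (m + 1)) := by ring

end SumBounds

/-! ### The weighted shifted data at the first level -/

section Weighted

variable (T : ℂ → H →L[ℂ] H) (Φ : (n : ℕ) → (Fin (n + 1) → E) → ℝ → (Fin n → ℝ) → H)
  (S₀ : (k : ℕ) → (Fin (k + 1) → E) → (Fin k → ℂ) → ℂ) (ε : ℝ) (Tw : ℕ) {m : ℕ} (c : Fin (m + 1 + 1) → E)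

/-- **The weighted shifted real-point function** `u ↦ ω_k(u) S₀ k c (u + ε⃗)`. [cite: OsterwalderSchraderCMP1975, Ch. VI.2 (6.21)] -/
def wSdat (u : Fin (m + 1) → ℝ) : ℂ :=
  osWeight (m + 1) ε Tw (fun j => (u j : ℂ)) * S₀ (m + 1) c fun j => ((u j + ε : ℝ) : ℂ)

/-- **The weighted shifted one-gap continuations** `(u', τ) ↦ ω_k(u'_0, …, τ, …) E_i(u' + ε⃗, τ + ε)`. [cite: OsterwalderSchraderCMP1975, Ch. VI.2 (6.21), Ch. V (5.4)] -/
def wEdat (i : Fin (m + 1)) (u' : Fin m → ℝ) (τ : ℂ) : ℂ :=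
  osWeight (m + 1) ε Tw (i.insertNth (α := fun _ => ℂ) τ fun j => (u' j : ℂ)) *
    slotE T Φ c i (fun j => u' j + ε) (τ + ε)

/-- **The level-`0` constant `Â_k = max (α k) (max CT 0 · ∑ᵢ √(α_{2i+1} α_{2(k-1-i)+1}))`.** [folklore] -/
def lev0A (CT : ℝ) (α : ℕ → ℝ) (k : ℕ) : ℝ :=
  max (α k) (max CT 0 * ∑ p : Fin k, Real.sqrt (α (p + 1 + p) * α (k - 1 - p + 1 + (k - 1 - p))))

/-- **The bound (6.28) at the first level**: `Â_k (1 + 4k/ε)^{tk} (6k)^{tk}`. [cite: OsterwalderSchraderCMP1975, Ch. VI.2 (6.28)] -/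
def lev0Const (CT : ℝ) (α : ℕ → ℝ) (t : ℕ) (k : ℕ) (ε : ℝ) : ℝ :=
  lev0A CT α k * (1 + 4 * k / ε) ^ (t * k) * (6 * k : ℝ) ^ (t * k)

variable {T Φ S₀ ε Tw c} {CT : ℝ} {good : (k : ℕ) → (Fin (k + 1) → E) → Prop} {C₀ : ℕ → ℝ} {p₀ : ℕ → ℕ}
  {α : ℕ → ℝ} {t : ℕ}

/-- `α k ≤ Â_k`. [folklore] -/
theorem le_lev0A_self (CT : ℝ) (α : ℕ → ℝ) (k : ℕ) : α k ≤ lev0A CT α k := le_max_left _ _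

/-- `max CT 0 · √(α_{2p+1} α_{2q+1}) ≤ Â_k`. [folklore] -/
theorem sqrt_le_lev0A (CT : ℝ) (α : ℕ → ℝ) {k : ℕ} (p : Fin k) :
    max CT 0 * Real.sqrt (α (p + 1 + p) * α (k - 1 - p + 1 + (k - 1 - p))) ≤ lev0A CT α k := by
  refine le_trans (mul_le_mul_of_nonneg_left (Finset.single_le_sum
    (f := fun q : Fin k => Real.sqrt (α (q + 1 + q) * α (k - 1 - q + 1 + (k - 1 - q))))
    (fun q _ => Real.sqrt_nonneg _) (Finset.mem_univ p)) (le_max_right _ _)) (le_max_right _ _)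

/-- `0 ≤ Â_k` if `0 ≤ α k`. [folklore] -/
theorem lev0A_nonneg {CT : ℝ} {α : ℕ → ℝ} (hα : ∀ k, 0 ≤ α k) (k : ℕ) : 0 ≤ lev0A CT α k :=
  (hα k).trans (le_lev0A_self CT α k)

/-- `0 ≤ lev0Const` if `0 ≤ α k`, `0 < ε`. [folklore] -/
theorem lev0Const_nonneg {CT : ℝ} {α : ℕ → ℝ} (hα : ∀ k, 0 ≤ α k) (t k : ℕ) {ε : ℝ} (hε : 0 < ε) :
    0 ≤ lev0Const CT α t k ε := by
  unfold lev0Const; have := lev0A_nonneg (CT := CT) hα k; positivity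

/-- `insertNth` of real data is real. [folklore] -/
theorem insertNth_ofReal (i : Fin (m + 1)) (x : ℝ) (u' : Fin m → ℝ) :
    (i.insertNth (α := fun _ => ℂ) (x : ℂ) fun j => (u' j : ℂ)) =
      fun j => ((i.insertNth x u' : Fin (m + 1) → ℝ) j : ℂ) := by
  funext j
  refine Fin.succAboveCases i ?_ (fun j' => ?_) j
  · simp only [Fin.insertNth_apply_same]
  · simp only [Fin.insertNth_apply_succAbove]

/-- `insertNth` commutes with adding a constant. [folklore] -/
theorem insertNth_add_const (i : Fin (m + 1)) (x ε : ℝ) (u' : Fin m → ℝ) :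
    (i.insertNth (x + ε) (fun j => u' j + ε) : Fin (m + 1) → ℝ) =
      fun j => (i.insertNth x u' : Fin (m + 1) → ℝ) j + ε := by
  funext j
  refine Fin.succAboveCases i ?_ (fun j' => ?_) j
  · simp only [Fin.insertNth_apply_same]
  · simp only [Fin.insertNth_apply_succAbove]

/-- Continuity of `u' ↦ (u'_0, …, τ, …)` (complex entries). [folklore] -/
theorem continuous_insertNth_ofReal (i : Fin (m + 1)) (τ : ℂ) :
    Continuous fun u' : Fin m → ℝ => i.insertNth (α := fun _ => ℂ) τ fun j => (u' j : ℂ) := by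
  refine continuous_pi fun j => ?_
  refine Fin.succAboveCases i ?_ (fun j' => ?_) j
  · simp only [Fin.insertNth_apply_same]; exact continuous_const
  · simp only [Fin.insertNth_apply_succAbove]; exact Complex.continuous_ofReal.comp (continuous_apply j')

/-- Holomorphy of `τ ↦ (u'_0, …, τ, …)`. [folklore] -/
theorem differentiable_insertNth (i : Fin (m + 1)) (u' : Fin m → ℝ) :
    Differentiable ℂ fun σ : ℂ => i.insertNth (α := fun _ => ℂ) σ fun j => (u' j : ℂ) := by
  refine differentiable_pi.2 fun j => ?_
  refine Fin.succAboveCases i ?_ (fun j' => ?_) j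
  · simp only [Fin.insertNth_apply_same]; exact differentiable_id
  · simp only [Fin.insertNth_apply_succAbove]; exact differentiable_const _

/-- The full vector `(u'_0, …, τ, …)` lies in `ℂ₊ᵏ`. [folklore] -/
theorem insertNth_re_pos (i : Fin (m + 1)) {u' : Fin m → ℝ} (hu : ∀ j, 0 < u' j) {τ : ℂ} (hτ : 0 < τ.re)
    (j : Fin (m + 1)) : 0 < ((i.insertNth (α := fun _ => ℂ) τ fun j => (u' j : ℂ)) j).re := by
  refine Fin.succAboveCases i ?_ (fun j' => ?_) j
  · rw [Fin.insertNth_apply_same]; exact hτ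
  · rw [Fin.insertNth_apply_succAbove]; simpa using hu j'

/-- **The real-point estimate** at the first level:
`‖ω_k(u) S₀ k c (u + ε⃗)‖ ≤ α k (1 + 4k/ε)^{tk} (6k)^{tk}`. [cite: OsterwalderSchraderCMP1975, Ch. VI.2 (6.20), (6.28) at N = 0] -/
theorem norm_wSdat_le (hα : ∀ k, 0 ≤ α k)
    (hsum : ∀ (k : ℕ) (c : Fin (k + 1) → E), good k c → ∀ ρ : Fin k → ℝ, (∀ i, 0 < ρ i) →
      ‖S₀ k c (fun i => (ρ i : ℂ))‖ ≤ α k * ((1 + ∑ i, ρ i) * (1 + ∑ i, (ρ i)⁻¹)) ^ (t * k))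
    (hc : good (m + 1) c) (hε0 : 0 < ε) (hε1 : ε ≤ 1) (htT : t ≤ Tw) {u : Fin (m + 1) → ℝ} (hu : ∀ j, 0 < u j) :
    ‖wSdat S₀ ε Tw c u‖ ≤ α (m + 1) * (1 + 4 * (m + 1 : ℕ) / ε) ^ (t * (m + 1)) * (6 * (m + 1 : ℕ) : ℝ) ^ (t * (m + 1)) := by
  have hk0 : 0 < m + 1 := Nat.succ_pos m
  set kR : ℝ := ((m + 1 : ℕ) : ℝ) with hkR
  have hk1 : (1 : ℝ) ≤ kR := by rw [hkR]; exact_mod_cast hk0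
  have hkpos : 0 < kR := lt_of_lt_of_le one_pos hk1
  have huε : ∀ j, 0 < u j + ε := fun j => by linarith [hu j]
  have hε' : 1 ≤ ε⁻¹ := one_le_inv_iff₀.2 ⟨hε0, hε1⟩
  -- the weight
  have hre : ∀ j, 0 < ((fun j => (u j : ℂ)) j).re := fun j => by simpa using hu j
  have hw := norm_osWeight_le hk0 hε0 Tw hre
  simp only [Complex.ofReal_re] at hw
  set B : ℝ := ε⁻¹ + (∑ j, u j) / kR with hB
  have hsumu : 0 ≤ ∑ j, u j := Finset.sum_nonneg fun j _ => (hu j).le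
  have hB1 : 1 ≤ B := by
    rw [hB]; have : 0 ≤ (∑ j, u j) / kR := by positivity
    linarith
  -- the real bound at `u + ε⃗`
  have hS := hsum (m + 1) c hc (fun j => u j + ε) huε
  set X : ℝ := 1 + ∑ j, (u j + ε) with hX
  have hX0 : 0 ≤ X := by
    rw [hX]; have : 0 ≤ ∑ j, (u j + ε) := Finset.sum_nonneg fun j _ => (huε j).le; linarith
  have hinv : 1 + ∑ j, (u j + ε)⁻¹ ≤ 1 + 4 * kR / ε := by
    have h := sum_inv_le_of_ge (n := m + 1) (e := fun j => u j + ε) hε0 fun j => by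
      show ε / 2 ≤ u j + ε; linarith [hu j]
    have h2 : ((m + 1 : ℕ) : ℝ) * (2 / ε) ≤ 4 * kR / ε := by
      rw [← hkR, show (4 : ℝ) * kR / ε = kR * (4 / ε) by ring]
      exact mul_le_mul_of_nonneg_left (by rw [div_le_div_iff_of_pos_right hε0]; norm_num) hkpos.le
    linarith
  have hXB : X ≤ 6 * kR * B := by
    have h3 : 6 * kR * B = 6 * kR * ε⁻¹ + 6 * ∑ j, u j := by rw [hB]; field_simp
    rw [hX, h3, Finset.sum_add_distrib, Finset.sum_const, Finset.card_univ, Fintype.card_fin, nsmul_eq_mul, ← hkR]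
    have h1 : kR * ε ≤ kR := by nlinarith
    nlinarith
  -- assemble
  rw [wSdat, norm_mul]
  calc ‖osWeight (m + 1) ε Tw fun j => (u j : ℂ)‖ * ‖S₀ (m + 1) c fun j => ((u j + ε : ℝ) : ℂ)‖
      ≤ (B ^ ((m + 1) * Tw))⁻¹ * (α (m + 1) * ((1 + ∑ j, (u j + ε)) * (1 + ∑ j, (u j + ε)⁻¹)) ^ (t * (m + 1))) :=
        mul_le_mul hw hS (norm_nonneg _) (by positivity)
    _ ≤ (B ^ ((m + 1) * Tw))⁻¹ * (α (m + 1) * (X * (1 + 4 * kR / ε)) ^ (t * (m + 1))) := by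
        refine mul_le_mul_of_nonneg_left (mul_le_mul_of_nonneg_left (pow_le_pow_left₀ ?_ ?_ _) (hα _))
          (by positivity)
        · have : 0 ≤ ∑ j, (u j + ε)⁻¹ := Finset.sum_nonneg fun j _ => (inv_pos.2 (huε j)).le
          positivity
        · exact mul_le_mul_of_nonneg_left hinv hX0
    _ = α (m + 1) * (1 + 4 * kR / ε) ^ (t * (m + 1)) * (X ^ (t * (m + 1)) * (B ^ ((m + 1) * Tw))⁻¹) := by
        rw [mul_pow]; ring
    _ ≤ α (m + 1) * (1 + 4 * kR / ε) ^ (t * (m + 1)) * (6 * kR) ^ (t * (m + 1)) :=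
        mul_le_mul_of_nonneg_left (core_pow_bound hX0 hXB hB1 htT) (by have := hα (m + 1); positivity)

/-- **The flat-tube estimate** at the first level, uniform in `Im τ`:
`‖ω_k(u'_0,…,τ,…) E_i(u' + ε⃗, τ + ε)‖ ≤ max CT 0 √(α_L α_R) (1 + 4k/ε)^{tk} (6k)^{tk}`. [cite: OsterwalderSchraderCMP1975, Ch. VI.2 (6.22), (6.28) at N = 0] -/
theorem norm_wEdat_le (hT : IsOSSemigroup T CT) (hD : IsOSLabelledRealData good S₀ Φ C₀ p₀)
    (hgood : IsOSLabelSet good) (hα : ∀ k, 0 ≤ α k)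
    (hsum : ∀ (k : ℕ) (c : Fin (k + 1) → E), good k c → ∀ ρ : Fin k → ℝ, (∀ i, 0 < ρ i) →
      ‖S₀ k c (fun i => (ρ i : ℂ))‖ ≤ α k * ((1 + ∑ i, ρ i) * (1 + ∑ i, (ρ i)⁻¹)) ^ (t * k))
    (hc : good (m + 1) c) (hε0 : 0 < ε) (hε1 : ε ≤ 1) (htT : t ≤ Tw) (i : Fin (m + 1))
    {u' : Fin m → ℝ} (hu : ∀ j, 0 < u' j) {τ : ℂ} (hτ : 0 < τ.re) :
    ‖wEdat T Φ ε Tw c i u' τ‖ ≤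
      max CT 0 * Real.sqrt (α (i + 1 + i) * α (m + 1 - 1 - i + 1 + (m + 1 - 1 - i))) *
        (1 + 4 * (m + 1 : ℕ) / ε) ^ (t * (m + 1)) * (6 * (m + 1 : ℕ) : ℝ) ^ (t * (m + 1)) := by
  have hk0 : 0 < m + 1 := Nat.succ_pos m
  -- the one-gap continuation at the shifted data (before abbreviating the casts)
  have hslot := norm_slotE_le_sum hT hD hgood hα hsum hc i hε0 (u' := fun j => u' j + ε)
    (fun j => by show ε ≤ u' j + ε; linarith [hu j]) (τ := τ + ε) (by simp; linarith)
  have hreτ : (τ + (ε : ℂ)).re = τ.re + ε := by simp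
  rw [hreτ] at hslot
  set kR : ℝ := ((m + 1 : ℕ) : ℝ) with hkR
  have hk1 : (1 : ℝ) ≤ kR := by rw [hkR]; exact_mod_cast hk0
  have hkpos : 0 < kR := lt_of_lt_of_le one_pos hk1
  have hε' : 1 ≤ ε⁻¹ := one_le_inv_iff₀.2 ⟨hε0, hε1⟩
  -- the weight at the full vector
  have hre := insertNth_re_pos i hu hτ
  have hw := norm_osWeight_le hk0 hε0 Tw hre
  have hsumre : ∑ j, ((i.insertNth (α := fun _ => ℂ) τ fun j => (u' j : ℂ)) j).re = τ.re + ∑ j, u' j := by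
    have h := congrArg Complex.re (sum_insertNth (α := ℂ) i τ fun j => (u' j : ℂ))
    rw [Complex.re_sum] at h
    rw [h, Complex.add_re, Complex.re_sum]
    simp only [Complex.ofReal_re]
  rw [hsumre] at hw
  have hsumu : 0 ≤ ∑ j, u' j := Finset.sum_nonneg fun j _ => (hu j).le
  set B : ℝ := ε⁻¹ + (τ.re + ∑ j, u' j) / kR with hB
  have hB1 : 1 ≤ B := by
    rw [hB]; have : 0 ≤ (τ.re + ∑ j, u' j) / kR := by positivity
    linarith
  set X : ℝ := 1 + 3 * kR + 2 * (τ.re + ε + ∑ j, (u' j + ε)) with hX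
  have hX0 : 0 ≤ X := by
    rw [hX]; have : 0 ≤ ∑ j, (u' j + ε) := Finset.sum_nonneg fun j _ => by linarith [hu j]
    positivity
  have hXB : X ≤ 6 * kR * B := by
    have h3 : 6 * kR * B = 6 * kR * ε⁻¹ + 6 * (τ.re + ∑ j, u' j) := by rw [hB]; field_simp
    rw [hX, h3, Finset.sum_add_distrib, Finset.sum_const, Finset.card_univ, Fintype.card_fin, nsmul_eq_mul]
    have hkR' : kR = m + 1 := by rw [hkR]; push_cast; ring
    have hmε' : (m : ℝ) * ε ≤ m := mul_le_of_le_one_right (Nat.cast_nonneg m) hε1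
    have h6 : 6 * kR ≤ 6 * kR * ε⁻¹ := by nlinarith [hε', hkpos]
    linarith [hτ, hsumu, hε1, hmε', h6, hkR', hk1]
  -- assemble
  rw [wEdat, norm_mul]
  set A : ℝ := max CT 0 * Real.sqrt (α (i + 1 + i) * α (m + 1 - 1 - i + 1 + (m + 1 - 1 - i))) with hA
  have hA0 : 0 ≤ A := by rw [hA]; exact mul_nonneg (le_max_right _ _) (Real.sqrt_nonneg _)
  calc ‖osWeight (m + 1) ε Tw (i.insertNth (α := fun _ => ℂ) τ fun j => (u' j : ℂ))‖ *
        ‖slotE T Φ c i (fun j => u' j + ε) (τ + ε)‖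
      ≤ (B ^ ((m + 1) * Tw))⁻¹ * (A * (X * (1 + 4 * kR / ε)) ^ (t * (m + 1))) :=
        mul_le_mul hw hslot (norm_nonneg _) (by positivity)
    _ = A * (1 + 4 * kR / ε) ^ (t * (m + 1)) * (X ^ (t * (m + 1)) * (B ^ ((m + 1) * Tw))⁻¹) := by
        rw [mul_pow]; ring
    _ ≤ A * (1 + 4 * kR / ε) ^ (t * (m + 1)) * (6 * kR) ^ (t * (m + 1)) :=
        mul_le_mul_of_nonneg_left (core_pow_bound hX0 hXB hB1 htT) (by positivity)

/-- **The weighted shifted data of a good label are bounded sector data of opening `π/2`**, with the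
constant `lev0Const`. [cite: OsterwalderSchraderCMP1975, Ch. V (5.4), Ch. VI.2 (6.21), (6.28)] -/
theorem isSectorData_weighted [CompleteSpace H] (hT : IsOSSemigroup T CT) (hΦ : IsOSLabelledVectors T Φ)
    (hgood : IsOSLabelSet good) (hD : IsOSLabelledRealData good S₀ Φ C₀ p₀) (hα : ∀ k, 0 ≤ α k)
    (hsum : ∀ (k : ℕ) (c : Fin (k + 1) → E), good k c → ∀ ρ : Fin k → ℝ, (∀ i, 0 < ρ i) →
      ‖S₀ k c (fun i => (ρ i : ℂ))‖ ≤ α k * ((1 + ∑ i, ρ i) * (1 + ∑ i, (ρ i)⁻¹)) ^ (t * k))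
    (hc : good (m + 1) c) (hε0 : 0 < ε) (hε1 : ε ≤ 1) (htT : t ≤ Tw) :
    IsSectorData (Real.pi / 2) (wSdat S₀ ε Tw c) (wEdat T Φ ε Tw c) (lev0Const CT α t (m + 1) ε) 0
      (fun _ => lev0Const CT α t (m + 1) ε) := by
  have hk0 : 0 < m + 1 := Nat.succ_pos m
  have hM0 := lev0Const_nonneg (CT := CT) hα t (m + 1) hε0
  have hMS : ∀ u : Fin (m + 1) → ℝ, (∀ j, 0 < u j) → ‖wSdat S₀ ε Tw c u‖ ≤ lev0Const CT α t (m + 1) ε := fun u hu =>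
    (norm_wSdat_le hα hsum hc hε0 hε1 htT hu).trans (by
      unfold lev0Const
      exact mul_le_mul_of_nonneg_right (mul_le_mul_of_nonneg_right (le_lev0A_self CT α (m + 1))
        (by positivity)) (by positivity))
  have hME : ∀ (i : Fin (m + 1)) (u' : Fin m → ℝ) (τ : ℂ), (∀ j, 0 < u' j) → 0 < τ.re →
      ‖wEdat T Φ ε Tw c i u' τ‖ ≤ lev0Const CT α t (m + 1) ε := fun i u' τ hu hτ =>
    (norm_wEdat_le hT hD hgood hα hsum hc hε0 hε1 htT i hu hτ).trans (by
      unfold lev0Const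
      exact mul_le_mul_of_nonneg_right (mul_le_mul_of_nonneg_right (sqrt_le_lev0A CT α i)
        (by positivity)) (by positivity))
  refine ⟨?_, hM0, fun u hu => by rw [pow_zero, mul_one]; exact hMS u hu, fun i τ hτ => ?_, fun i u' hu => ?_,
    fun _ => hM0, fun i c' _ u' τ hu hτ _ => by rw [pow_zero, pow_zero, mul_one, mul_one]; exact hME i u' τ hu hτ,
    fun i u' hu x hx => ?_⟩
  · -- continuity of the real-point function on the open orthant
    refine ContinuousOn.mul ?_ ?_
    · refine (differentiableOn_osWeight hk0 hε0 Tw).continuousOn.comp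
        (continuous_pi fun j => Complex.continuous_ofReal.comp (continuous_apply j)).continuousOn
        fun u hu j => by simpa using hu j
    · exact (hD.cont (m + 1) c hc).comp (continuous_pi fun j => (continuous_apply j).add continuous_const).continuousOn
        fun u hu j => by show 0 < u j + ε; linarith [hu j]
  · -- continuity of the flat-tube data in the other gaps
    refine ContinuousOn.mul ?_ ?_
    · exact (differentiableOn_osWeight hk0 hε0 Tw).continuousOn.comp (continuous_insertNth_ofReal i τ).continuousOn
        fun u' hu j => insertNth_re_pos i hu hτ.1 j
    · have hτ' : 0 < (τ + (ε : ℂ)).re := by simp; linarith [hτ.1]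
      exact (continuousOn_slotE (T := T) hD hgood hc i hτ').comp
        (continuous_pi fun j => (continuous_apply j).add continuous_const).continuousOn
        fun u' hu j => by show 0 < u' j + ε; linarith [hu j]
  · -- holomorphy of the flat-tube data in `τ`
    refine DifferentiableOn.mul ?_ ?_
    · exact ((differentiableOn_osWeight hk0 hε0 Tw).comp (differentiable_insertNth i u').differentiableOn
        fun σ hσ j => insertNth_re_pos i hu hσ j).mono fun σ hσ => hσ.1
    · have huε : ∀ j, 0 < u' j + ε := fun j => by linarith [hu j]
      exact ((differentiableOn_slotE hT hΦ c i huε).comp ((differentiable_id.add_const (ε : ℂ)).differentiableOn)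
        fun σ (hσ : 0 < σ.re) => by show 0 < (σ + (ε : ℂ)).re; simp; linarith).mono fun σ hσ => hσ.1
  · -- the flat-tube data restrict to the real-point function
    have huε : ∀ j, 0 < u' j + ε := fun j => by linarith [hu j]
    have hxε : 0 < x + ε := by linarith
    rw [wEdat, wSdat, insertNth_ofReal, show (x : ℂ) + (ε : ℂ) = ((x + ε : ℝ) : ℂ) by push_cast; ring,
      slotE_ofReal hΦ hD c i huε hxε, insertNth_add_const]

/-- The argument region of `c_{m+1}^{(1)}` in terms of the `ℓ¹`-sum of the arguments. [folklore] -/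
theorem mem_sectorRegion_of_lt {c' : ℝ} {Z : Fin (m + 1) → ℂ} (hZ : ∀ j, 0 < (Z j).re)
    (hsum : ∑ j, |(Z j).arg| < c') : Z ∈ sectorRegion m c' := ⟨hZ, hsum⟩

/-- **The bound (6.28) at the first level** (OS II Ch. VI.2, "for `N = 0`, (6.28) follows from
(6.20)"): let `Sfam` be any family holomorphic on `ℂ₊ᵏ` for the good labels and equal to `S₀` at the
positive real points (e.g. the tower of `OSLabelledTower` started at `exists_levelZero`). Then for
`0 < ε ≤ 1`, `t ≤ Tw`, every `m` and every good label `c`, the regularised function satisfies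
`‖S_{m+1,ε}(Z)‖ ≤ lev0Const CT α t (m+1) ε` on the region of `c_{m+1}^{(1)}` — by the growth-free
maximum principle on the flat tubes applied to the weighted shifted data. [cite: OsterwalderSchraderCMP1975, Ch. VI.2 (6.20)–(6.22), (6.28)] -/
theorem norm_regFun_le_levelZero [CompleteSpace H] (hT : IsOSSemigroup T CT) (hΦ : IsOSLabelledVectors T Φ)
    (hgood : IsOSLabelSet good) (hD : IsOSLabelledRealData good S₀ Φ C₀ p₀) (hα : ∀ k, 0 ≤ α k)
    (hsum : ∀ (k : ℕ) (c : Fin (k + 1) → E), good k c → ∀ ρ : Fin k → ℝ, (∀ i, 0 < ρ i) →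
      ‖S₀ k c (fun i => (ρ i : ℂ))‖ ≤ α k * ((1 + ∑ i, ρ i) * (1 + ∑ i, (ρ i)⁻¹)) ^ (t * k))
    (hε0 : 0 < ε) (hε1 : ε ≤ 1) (htT : t ≤ Tw)
    {Sfam : (k : ℕ) → (Fin (k + 1) → E) → (Fin k → ℂ) → ℂ}
    (hhol : ∀ (k : ℕ) (c : Fin (k + 1) → E), good k c → 0 < k → DifferentiableOn ℂ (Sfam k c) {Z | ∀ i, 0 < (Z i).re})
    (hreal : ∀ (k : ℕ) (c : Fin (k + 1) → E), good k c → ∀ ρ : Fin k → ℝ, (∀ i, 0 < ρ i) →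
      Sfam k c (fun i => (ρ i : ℂ)) = S₀ k c (fun i => (ρ i : ℂ)))
    (hc : good (m + 1) c) {Z : Fin (m + 1) → ℂ} (hZ : Z ∈ argRegion (osBaseC 1 (m + 1))) :
    ‖regFun Sfam ε Tw (m + 1) c Z‖ ≤ lev0Const CT α t (m + 1) ε := by
  have hk0 : 0 < m + 1 := Nat.succ_pos m
  have hsd := isSectorData_weighted hT hΦ hgood hD hα hsum hc hε0 hε1 htT
  -- the regularised function is holomorphic on the sector region and restricts to the weighted data
  have hG : DifferentiableOn ℂ (regFun Sfam ε Tw (m + 1) c) (sectorRegion m (Real.pi / 2)) :=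
    (differentiableOn_regFun hhol hε0 hk0 hc).mono fun w hw => hw.1
  have hGreal : ∀ u : Fin (m + 1) → ℝ, (∀ j, 0 < u j) →
      regFun Sfam ε Tw (m + 1) c (fun j => (u j : ℂ)) = wSdat S₀ ε Tw c u := by
    intro u hu
    have huε : ∀ j, 0 < u j + ε := fun j => by linarith [hu j]
    have hshift : shiftVec ε (fun j => (u j : ℂ)) = fun j => ((u j + ε : ℝ) : ℂ) := by
      funext j; simp [shiftVec]
    rw [regFun, wSdat, hshift, hreal (m + 1) c hc (fun j => u j + ε) huε]
  -- the point lies in a sector region of opening `< π/2`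
  rw [argRegion_osBaseC_one] at hZ
  set s : ℝ := ∑ j, |(Z j).arg| with hs
  have hsπ : s < Real.pi / 2 := hZ.2
  have hs0 : 0 ≤ s := Finset.sum_nonneg fun j _ => abs_nonneg _
  set c' : ℝ := (s + Real.pi / 2) / 2 with hc'
  have hc'0 : 0 < c' := by rw [hc']; linarith [Real.pi_pos]
  have hc'π : c' < Real.pi / 2 := by rw [hc']; linarith
  have hZc' : Z ∈ sectorRegion m c' := ⟨hZ.1, by rw [hc']; linarith⟩
  have hM := hsd.norm_extension_le le_rfl hG hGreal hc'0 hc'π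
    (fun u hu => by simpa using hsd.bound u hu)
    (fun i u' τ hu hτ _ => (norm_wEdat_le hT hD hgood hα hsum hc hε0 hε1 htT i hu hτ).trans (by
        unfold lev0Const
        exact mul_le_mul_of_nonneg_right (mul_le_mul_of_nonneg_right (sqrt_le_lev0A CT α i)
          (by positivity)) (by positivity))) hZc'
  exact hM

end Weighted

end Literature.MathematicalPhysics.QuantumFieldTheory.OSEnvelope
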